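import Summits.AnomalousDissipation.AnomalousDissipation.Theorems.ImpulseGridGridSignsLawOfAcdc
import Summits.AnomalousDissipation.AnomalousDissipation.Theorems.ImpulseGridGridSignsLawStubLoudWakes
import Summits.AnomalousDissipation.AnomalousDissipation.Theorems.ImpulseGridGridThesisOfAcdc
import Summits.AnomalousDissipation.AnomalousDissipation.Theorems.ImpulseGridAssembly
import Summits.AnomalousDissipation.AnomalousDissipation.Theorems.ImpulseGridGridInjectionIdentity
import Summits.AnomalousDissipation.AnomalousDissipation.Theorems.ImpulseGridGridThesisStubWorkSplitTransfer
import Summits.AnomalousDissipation.AnomalousDissipation.Theorems.ImpulseGridGridThesisStubAlphaBalance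
import Summits.AnomalousDissipation.AnomalousDissipation.Theorems.ImpulseGridGridThesisStubAcWorkOfQuadratureDrag
import Summits.AnomalousDissipation.AnomalousDissipation.Theorems.ImpulseGridGridThesisStubAcdcDesignCalculus
import Summits.AnomalousDissipation.AnomalousDissipation.Theorems.ImpulseGridGridThesisStubAcdcDesignIntegrals

/-!
# STRATEGY CENSUS (Lean part) — crux `ImpulseGrid.AcdcFirstMomentLaw` (stmt-AnomalousDissipation-18236)

Crux strategist `planner-cstrat-stmt-AnomalousDissipation-18236-r1` (REDIRECT r1, 2026-08-17).
Companion of `Cruxes/AcdcFirstMomentLaw/STRATEGY-CENSUS.md`; every theorem here is sorry-free and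
uses only LANDED files of the route (`Theorems/ImpulseGrid*.lean`) and the route file.

The crux `C := AcdcFirstMomentLaw` (∃ parameters `(m, A, θ, c)` of the explicit AC/DC grid force
`Φ • G`, ∀ bounded-energy vanishing-viscosity global Leray–Hopf drift families: eventually in `j`,
in one generalized limit `Λ`, (DC) `0 ≤ Λ⟨(G,u_j)⟩` and (AC) `κ ≤ Λ⟨((Φ−1)•G,u_j)⟩`).

Contents.

* §1 `summit_of_crux_of_acdcEnergyNoLeak` — the route's `closes` with its three proved binders
  discharged: `C → AcdcEnergyNoLeak → AnomalousDissipation`.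
* §2 THE COSTUME. `AcdcUniversalInjectionFloor` (`U`: ∃ parameters, ∀ bounded-energy drift families,
  eventually `ι ≤ Λ⟨(Φ•G, u_j)⟩`, `ι > 0`) — the zeroth law's injection floor demanded of EVERY
  bounded-energy Leray–Hopf wake of ONE explicit steady force.  `uif_of_crux : C → U` (DC + AC =
  injection, landed work split), `loud_of_uifAt` (under `U`, every bounded no-leak drift family has
  `meanDissipation ≥ ι` eventually — it IS a zeroth-law witness after a tail shift) and
  `summit_of_uif_of_acdcEnergyNoLeak : U → AcdcEnergyNoLeak → AnomalousDissipation`: the route's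
  `closes` consumes NOTHING of `C` beyond `U`; the DC/AC sign split is not load-bearing.
* §3 VACUITY DOOR. `crux_of_noBoundedDriftFamily`: if at some parameters NO bounded-energy drift
  family exists (a 3-D Marchioro-type laminar theorem — none is known, and DNS j018908 shows
  saturated turbulence at these designs), `C` holds vacuously; and the same hypothesis REFUTES the
  sibling crux (`not_acdcEnergyNoLeak_of_noBoundedDriftFamily`).  So the two open binders of
  `closes` can only hold together NON-vacuously: `C`'s usable content is exactly `U`.
* §4 DECOMPOSITION D1 (the birth skeleton, typed as Props): `DcNoReversalLaw ∧ AcDragLaw → C`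
  (`crux_of_dcNoReversal_of_acDrag`, real content: the landed modal `α`-balance).  Both pieces are
  ν-uniform ∀-family SIGN laws of the same species as `C`; see the markdown for why neither is a
  smaller problem.
* §5 NEGATION, typed: `¬C ↔ QuietOrReversingFamilies` and `boundedDriftFamilies_of_not_crux`:
  refuting `C` requires, at EVERY parameter `(m, A, θ, c)`, a ν-uniformly bounded-energy
  vanishing-viscosity Leray–Hopf drift family of the AC/DC force — the open existence problem of the
  sibling crux (`UEDF`, census of stmt-14350) before any sign can even be tested.
-/

noncomputable section

open MeasureTheory Set Filter Topology
open scoped InnerProductSpace RealInnerProductSpace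

-- `Summit.<Summit>.<Problem>` is the tree's mandated summit-side namespace (CONVENTIONS §2).
set_option linter.dupNamespace false

namespace Summit.AnomalousDissipation.AnomalousDissipation.Cruxes.AcdcFirstMomentLaw.StrategyCensus

open Literature.Analysis.FunctionSpaces Literature.Analysis.FunctionSpaces.Torus
open Literature.Analysis.FluidPDE Literature.Analysis.FluidPDE.Torus
open Summit.AnomalousDissipation.AnomalousDissipation.Theses.ImpulseGrid
open Summit.AnomalousDissipation.AnomalousDissipation.Theorems

local notation "𝕋³" => UnitAddTorus (Fin 3)
local notation "E³" => EuclideanSpace ℝ (Fin 3)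

/-! ### §0 The explicit AC/DC design, as predicates on `(Φ, G)` -/

/-- `Φ` is the AC/DC slab profile `1 + 2θ cos 2πx₀`. [folklore] -/
def IsAcdcProfile (θ : ℝ) (Φ : 𝕋³ → ℝ) : Prop :=
  Φ = fun x => 1 + 2 * θ * (UnitAddTorus.mFourier (Pi.single (0 : Fin 3) (1 : ℤ)) x).re

/-- `G` is the cellular two-mode Stokes pattern `A[sin 2πm(x₁+x₂)(e₁−e₂) + sin 2πm(x₁−x₂)(e₁+e₂)]`. [folklore] -/
def IsAcdcPattern (m : ℕ) (A : ℝ) (G : 𝕋³ → E³) : Prop :=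
  G = fun x => A • (stokesMode ![(0 : ℤ), (m : ℤ), (m : ℤ)]
        (EuclideanSpace.single (1 : Fin 3) (1 : ℝ) - EuclideanSpace.single (2 : Fin 3) (1 : ℝ)) false x +
      stokesMode ![(0 : ℤ), (m : ℤ), -(m : ℤ)]
        (EuclideanSpace.single (1 : Fin 3) (1 : ℝ) + EuclideanSpace.single (2 : Fin 3) (1 : ℝ)) false x)

/-- A bounded-energy vanishing-viscosity global Leray–Hopf DRIFT FAMILY of the force `Φ • G` with
drift `c` and mean-energy bound `E` (exactly the hypothesis list of the crux). [folklore] -/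
def IsBoundedDriftFamily (Φ : 𝕋³ → ℝ) (G : 𝕋³ → E³) (c : ℝ) (ν : ℕ → ℝ) (u₀ : ℕ → 𝕋³ → E³)
    (u : ℕ → ℝ → 𝕋³ → E³) (E : ℝ) : Prop :=
  (∀ j, 0 < ν j) ∧ Tendsto ν atTop (𝓝 0) ∧
    (∀ j, IsGlobalLerayHopf (ν j) (fun _ => fun x => Φ x • G x) (u₀ j) (u j)) ∧
    (∀ j, ∃ C : ℝ, ∀ t : ℝ, 0 ≤ t → kineticEnergy (u j t) ≤ C) ∧
    (∀ j, ∫ x, u₀ j x = c • EuclideanSpace.single 0 1) ∧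
    (∀ j, meanEnergy (u j) ≤ E)

/-! ### §1 Upper pin: the route's `closes` with its proved binders discharged -/

/-- **`C → AcdcEnergyNoLeak → AnomalousDissipation`**: the deciding theorem `closes` of route
ImpulseGrid (rev 8) with its three proved binders (`gridThesisOfAcdc_proof`,
`impulseGrid_gridInjectionIdentity`, `impulseGridAssembly_proof`) supplied. [folklore] -/
theorem summit_of_crux_of_acdcEnergyNoLeak :
    AcdcFirstMomentLaw → AcdcEnergyNoLeak → _root_.AnomalousDissipation :=
  fun h₁ h₂ => closes h₁ h₂ gridThesisOfAcdc_proof impulseGrid_gridInjectionIdentity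
    impulseGridAssembly_proof

/-! ### §2 The costume: the universal injection floor `U` -/

/-- `U` at fixed parameters: EVERY bounded-energy drift family of the AC/DC force at `(m, A, θ, c)`
has, eventually in `j` and in one generalized limit, a positive floor `ι` under its mean energy
injection `Λ⟨(Φ•G, u_j)⟩`. [folklore] -/
def UIFAt (m : ℕ) (A θ c : ℝ) : Prop :=
  ∀ (Φ : 𝕋³ → ℝ) (G : 𝕋³ → E³), IsAcdcProfile θ Φ → IsAcdcPattern m A G →
    ∀ (ν : ℕ → ℝ) (u₀ : ℕ → 𝕋³ → E³) (u : ℕ → ℝ → 𝕋³ → E³) (E : ℝ),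
      IsBoundedDriftFamily Φ G c ν u₀ u E →
      ∃ ι : ℝ, 0 < ι ∧ ∃ (Λ : GeneralizedLimit) (J : ℕ), ∀ j, J ≤ j →
        ι ≤ Λ.longTimeAvg (fun t => ∫ x, ⟪Φ x • G x, u j t x⟫)

/-- **`U` = `AcdcUniversalInjectionFloor`** (∃ parameters, ∀ families): the zeroth law's floor —
here on the INJECTION `⟨(f,u)⟩`, which dominates `ν⟨‖∇u‖²⟩` by the Leray–Hopf energy inequality
and equals it under no-leak — demanded of EVERY bounded-energy Leray–Hopf wake of one explicit
steady force. [folklore] -/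
def AcdcUniversalInjectionFloor : Prop :=
  ∃ (m : ℕ) (A θ c : ℝ), 1 ≤ m ∧ 0 < A ∧ 0 < θ ∧ 0 < c ∧ UIFAt m A θ c

/-- **`C → U`**: DC `≥ 0` and AC `≥ κ` give injection `≥ κ`, because the injection splits as
DC + AC (`WorkSplitTransfer.longTimeAvg_inner_sub_one_smul`, landed). [folklore] -/
theorem uif_of_crux : AcdcFirstMomentLaw → AcdcUniversalInjectionFloor := by
  rintro ⟨m, A, θ, c, hm, hA, hθ, hc, hlaw⟩
  refine ⟨m, A, θ, c, hm, hA, hθ, hc, ?_⟩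
  intro Φ G hΦd hGd ν u₀ u E hfam
  obtain ⟨hν, hν0, hu, hsup, hdrift, hE⟩ := hfam
  -- smoothness of the explicit fields (two of the fifteen design clauses)
  set Ψ : 𝕋³ → ℝ :=
    fun x => θ / Real.pi * (UnitAddTorus.mFourier (Pi.single (0 : Fin 3) (1 : ℤ)) x).im with hΨd
  obtain ⟨hΦ, -, hG, -⟩ := stub_acdcGridAdmissible m A θ c Φ Ψ G hΦd hΨd hGd hm hA hθ hc
  obtain ⟨κ, hκ, Λ, J, hJ⟩ := hlaw Φ G hΦd hGd ν u₀ u E hν hν0 hu hsup hdrift hE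
  refine ⟨κ, hκ, Λ, J, fun j hj => ?_⟩
  obtain ⟨ha, hb⟩ := hJ j hj
  have hsplit := WorkSplitTransfer.longTimeAvg_inner_sub_one_smul Λ hΦ.continuous hG.continuous
    (hu j)
  rw [hsplit] at hb
  linarith

/-- **Under `U`, every bounded-energy NO-LEAK drift family is LOUD**: `meanDissipation ≥ ι`
eventually in `j` (`ι ≤ Λ⟨(f,u_j)⟩ ≤ limsup`-mean injection `≤ meanDissipation`; the middle step is
`LoudWakes.longTimeAvg_inner_le_longTimeAvgSup`, landed).  This is the dissipative clause of
`Literature.Turb.ZerothLaw` for EVERY candidate family of the force instead of ONE. [folklore] -/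
theorem loud_of_uifAt {m : ℕ} {A θ c : ℝ} (hm : 1 ≤ m) (hA : 0 < A) (hθ : 0 < θ) (hc : 0 < c)
    (hU : UIFAt m A θ c) {Φ : 𝕋³ → ℝ} {G : 𝕋³ → E³} (hΦd : IsAcdcProfile θ Φ)
    (hGd : IsAcdcPattern m A G) {ν : ℕ → ℝ} {u₀ : ℕ → 𝕋³ → E³} {u : ℕ → ℝ → 𝕋³ → E³} {E : ℝ}
    (hfam : IsBoundedDriftFamily Φ G c ν u₀ u E)
    (hNL : ∀ j, longTimeAvgSup (fun t => ∫ x, ⟪Φ x • G x, u j t x⟫) ≤ meanDissipation (ν j) (u j)) :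
    ∃ ι : ℝ, 0 < ι ∧ ∃ J : ℕ, ∀ j, J ≤ j → ι ≤ meanDissipation (ν j) (u j) := by
  obtain ⟨ι, hι, Λ, J, hJ⟩ := hU Φ G hΦd hGd ν u₀ u E hfam
  obtain ⟨-, -, hu, hsup, -, -⟩ := hfam
  set Ψ : 𝕋³ → ℝ :=
    fun x => θ / Real.pi * (UnitAddTorus.mFourier (Pi.single (0 : Fin 3) (1 : ℤ)) x).im with hΨd
  obtain ⟨-, -, -, -, -, -, -, -, -, -, -, hfs, -⟩ :=
    stub_acdcGridAdmissible m A θ c Φ Ψ G hΦd hΨd hGd hm hA hθ hc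
  refine ⟨ι, hι, J, fun j hj => ?_⟩
  exact (hJ j hj).trans
    ((LoudWakes.longTimeAvg_inner_le_longTimeAvgSup Λ hfs.continuous (hu j) (hsup j)).trans (hNL j))

/-- **`U → AcdcEnergyNoLeak → AnomalousDissipation`**: the summit from the universal injection
floor and the existence crux ALONE — the DC/AC sign split inside `C` is not consumed.  Proof:
parameters from `U`; the family from the existence crux; per-`j` sup-energy bounds from the
Leray–Hopf energy inequality (`IsGlobalLerayHopf.exists_forall_integral_norm_sq_le_of_hasZeroMean`);
`loud_of_uifAt`; tail shift `j ↦ j + J`; `f = Φ • G` is smooth, divergence-free and mean-zero by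
the landed design calculus (`stub_acdcGridAdmissible`). [folklore] -/
theorem summit_of_uif_of_acdcEnergyNoLeak :
    AcdcUniversalInjectionFloor → AcdcEnergyNoLeak → _root_.AnomalousDissipation := by
  rintro ⟨m, A, θ, c, hm, hA, hθ, hc, hU⟩ hEx
  -- the explicit design and its clauses
  set Φ : 𝕋³ → ℝ :=
    fun x => 1 + 2 * θ * (UnitAddTorus.mFourier (Pi.single (0 : Fin 3) (1 : ℤ)) x).re with hΦd
  set Ψ : 𝕋³ → ℝ :=
    fun x => θ / Real.pi * (UnitAddTorus.mFourier (Pi.single (0 : Fin 3) (1 : ℤ)) x).im with hΨd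
  set G : 𝕋³ → E³ := fun x =>
    A • (stokesMode ![(0 : ℤ), (m : ℤ), (m : ℤ)]
        (EuclideanSpace.single (1 : Fin 3) (1 : ℝ) - EuclideanSpace.single (2 : Fin 3) (1 : ℝ)) false x +
      stokesMode ![(0 : ℤ), (m : ℤ), -(m : ℤ)]
        (EuclideanSpace.single (1 : Fin 3) (1 : ℝ) + EuclideanSpace.single (2 : Fin 3) (1 : ℝ)) false x)
    with hGd
  obtain ⟨-, -, -, -, -, -, -, -, -, -, -, hfs, hfd, hfm, -⟩ :=
    stub_acdcGridAdmissible m A θ c Φ Ψ G hΦd hΨd hGd hm hA hθ hc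
  -- the bounded-energy no-leak drift family at these parameters
  obtain ⟨ν, u₀, u, hν, hν0, hu, hdrift, ⟨E, hE⟩, hNL⟩ := hEx m A θ c hm hA hθ hc Φ G hΦd hGd
  -- per-`j` sup-in-time kinetic-energy bounds (Leray–Hopf, mean-zero steady force, `ν_j > 0`)
  have hsup : ∀ j, ∃ C₀ : ℝ, ∀ t : ℝ, 0 ≤ t → kineticEnergy (u j t) ≤ C₀ := by
    intro j
    obtain ⟨R₀, hR₀⟩ :=
      (hu j).exists_forall_integral_norm_sq_le_of_hasZeroMean (hν j) (hfs.memLp 2) hfm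
    refine ⟨2⁻¹ * R₀, fun t ht => ?_⟩
    unfold kineticEnergy
    exact mul_le_mul_of_nonneg_left (hR₀ t ht) (by norm_num)
  have hfam : IsBoundedDriftFamily Φ G c ν u₀ u E := ⟨hν, hν0, hu, hsup, hdrift, hE⟩
  obtain ⟨ι, hι, J, hJ⟩ := loud_of_uifAt hm hA hθ hc hU hΦd hGd hfam hNL
  -- the zeroth law along the tail `j ↦ j + J`
  show Literature.Turb.ZerothLaw
  exact ⟨fun x => Φ x • G x, hfs, hfd, hfm, fun j => ν (j + J), fun j => u₀ (j + J),
    fun j => u (j + J), fun j => hν _, hν0.comp (tendsto_add_atTop_nat J), fun j => hu _,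
    ⟨E, fun j => hE _⟩, ι, hι, fun j => hJ (j + J) (Nat.le_add_left _ _)⟩

/-- Corollary: **`C → AcdcEnergyNoLeak → AnomalousDissipation` factors through `U`** — an
independent proof of §1 that never looks at the two signs separately. [folklore] -/
theorem summit_of_crux_of_acdcEnergyNoLeak' :
    AcdcFirstMomentLaw → AcdcEnergyNoLeak → _root_.AnomalousDissipation :=
  fun h₁ h₂ => summit_of_uif_of_acdcEnergyNoLeak (uif_of_crux h₁) h₂

/-! ### §3 The vacuity door (and why it closes the sibling crux) -/

/-- No bounded-energy vanishing-viscosity Leray–Hopf drift family exists for the AC/DC force at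
`(m, A, θ, c)` — the conclusion of a (hypothetical, 3-D) Marchioro-type laminar-attraction theorem
at this design. [folklore] -/
def NoBoundedDriftFamilyAt (m : ℕ) (A θ c : ℝ) : Prop :=
  ∀ (Φ : 𝕋³ → ℝ) (G : 𝕋³ → E³), IsAcdcProfile θ Φ → IsAcdcPattern m A G →
    ∀ (ν : ℕ → ℝ) (u₀ : ℕ → 𝕋³ → E³) (u : ℕ → ℝ → 𝕋³ → E³) (E : ℝ),
      ¬ IsBoundedDriftFamily Φ G c ν u₀ u E

/-- **Vacuity door**: if some admissible parameters carry no bounded drift family, the crux holds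
with nothing to check. [folklore] -/
theorem crux_of_noBoundedDriftFamily
    (h : ∃ (m : ℕ) (A θ c : ℝ), 1 ≤ m ∧ 0 < A ∧ 0 < θ ∧ 0 < c ∧ NoBoundedDriftFamilyAt m A θ c) :
    AcdcFirstMomentLaw := by
  obtain ⟨m, A, θ, c, hm, hA, hθ, hc, hno⟩ := h
  refine ⟨m, A, θ, c, hm, hA, hθ, hc, ?_⟩
  intro Φ G hΦd hGd ν u₀ u E hν hν0 hu hsup hdrift hE
  exact (hno Φ G hΦd hGd ν u₀ u E ⟨hν, hν0, hu, hsup, hdrift, hE⟩).elim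

/-- **The same door REFUTES the sibling crux**: `AcdcEnergyNoLeak` produces, at every parameter, a
bounded drift family (per-`j` caps from the Leray–Hopf class), contradicting
`NoBoundedDriftFamilyAt`.  Hence the two open binders of `closes` hold together only
NON-vacuously, where `C`'s content is `U` (§2). [folklore] -/
theorem not_acdcEnergyNoLeak_of_noBoundedDriftFamily {m : ℕ} {A θ c : ℝ} (hm : 1 ≤ m)
    (hA : 0 < A) (hθ : 0 < θ) (hc : 0 < c) (hno : NoBoundedDriftFamilyAt m A θ c) :
    ¬ AcdcEnergyNoLeak := by
  intro hEx
  set Φ : 𝕋³ → ℝ :=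
    fun x => 1 + 2 * θ * (UnitAddTorus.mFourier (Pi.single (0 : Fin 3) (1 : ℤ)) x).re with hΦd
  set Ψ : 𝕋³ → ℝ :=
    fun x => θ / Real.pi * (UnitAddTorus.mFourier (Pi.single (0 : Fin 3) (1 : ℤ)) x).im with hΨd
  set G : 𝕋³ → E³ := fun x =>
    A • (stokesMode ![(0 : ℤ), (m : ℤ), (m : ℤ)]
        (EuclideanSpace.single (1 : Fin 3) (1 : ℝ) - EuclideanSpace.single (2 : Fin 3) (1 : ℝ)) false x +
      stokesMode ![(0 : ℤ), (m : ℤ), -(m : ℤ)]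
        (EuclideanSpace.single (1 : Fin 3) (1 : ℝ) + EuclideanSpace.single (2 : Fin 3) (1 : ℝ)) false x)
    with hGd
  obtain ⟨-, -, -, -, -, -, -, -, -, -, -, hfs, -, hfm, -⟩ :=
    stub_acdcGridAdmissible m A θ c Φ Ψ G hΦd hΨd hGd hm hA hθ hc
  obtain ⟨ν, u₀, u, hν, hν0, hu, hdrift, ⟨E, hE⟩, -⟩ := hEx m A θ c hm hA hθ hc Φ G hΦd hGd
  have hsup : ∀ j, ∃ C₀ : ℝ, ∀ t : ℝ, 0 ≤ t → kineticEnergy (u j t) ≤ C₀ := by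
    intro j
    obtain ⟨R₀, hR₀⟩ :=
      (hu j).exists_forall_integral_norm_sq_le_of_hasZeroMean (hν j) (hfs.memLp 2) hfm
    refine ⟨2⁻¹ * R₀, fun t ht => ?_⟩
    unfold kineticEnergy
    exact mul_le_mul_of_nonneg_left (hR₀ t ht) (by norm_num)
  exact hno Φ G hΦd hGd ν u₀ u E ⟨hν, hν0, hu, hsup, hdrift, hE⟩

/-! ### §4 Decomposition D1 — the birth skeleton's two pieces, typed -/

/-- Piece 1 (DC; ∀ parameters, ∀ generalized limits): NO REVERSAL of the circuit-mean imprint —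
verbatim `stub_acdcNoReversalLaw` of `Cruxes/GridThesis/Lines/AcdcFirstMomentLaw_birth.lean`. [folklore] -/
def DcNoReversalLaw : Prop :=
  ∀ (m : ℕ) (A θ c : ℝ), 1 ≤ m → 0 < A → 0 < θ → 0 < c →
    ∀ (Φ : 𝕋³ → ℝ) (G : 𝕋³ → E³), IsAcdcProfile θ Φ → IsAcdcPattern m A G →
      ∀ (ν : ℕ → ℝ) (u₀ : ℕ → 𝕋³ → E³) (u : ℕ → ℝ → 𝕋³ → E³) (E : ℝ),
        (∀ j, 0 < ν j) → Tendsto ν atTop (𝓝 0) →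
        (∀ j, IsGlobalLerayHopf (ν j) (fun _ => fun x => Φ x • G x) (u₀ j) (u j)) →
        (∀ j, ∃ C : ℝ, ∀ t : ℝ, 0 ≤ t → kineticEnergy (u j t) ≤ C) →
        (∀ j, ∫ x, u₀ j x = c • EuclideanSpace.single 0 1) →
        (∀ j, meanEnergy (u j) ≤ E) →
        ∃ J : ℕ, ∀ j, J ≤ j → ∀ Λ : GeneralizedLimit,
          0 ≤ Λ.longTimeAvg (fun t => ∫ x, ⟪G x, u j t x⟫)

/-- Piece 2 (AC; ∃ parameters): AC EDDY DRAG on the swept quadrature pair `C = cos(2πx₀)G`,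
`S = sin(2πx₀)G` — verbatim `stub_acdcAcDragLaw` of the birth skeleton.  By the exact modal
`α`-balance this is a REFORMULATION of the AC floor along bounded families (markdown §Decomposition). [folklore] -/
def AcDragLaw : Prop :=
  ∃ (m : ℕ) (A θ c : ℝ), 1 ≤ m ∧ 0 < A ∧ 0 < θ ∧ 0 < c ∧
    ∀ (Φ : 𝕋³ → ℝ) (G C S : 𝕋³ → E³), IsAcdcProfile θ Φ → IsAcdcPattern m A G →
      C = (fun x => (UnitAddTorus.mFourier (Pi.single (0 : Fin 3) (1 : ℤ)) x).re • G x) →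
      S = (fun x => (UnitAddTorus.mFourier (Pi.single (0 : Fin 3) (1 : ℤ)) x).im • G x) →
      ∀ (ν : ℕ → ℝ) (u₀ : ℕ → 𝕋³ → E³) (u : ℕ → ℝ → 𝕋³ → E³) (E : ℝ),
        (∀ j, 0 < ν j) → Tendsto ν atTop (𝓝 0) →
        (∀ j, IsGlobalLerayHopf (ν j) (fun _ => fun x => Φ x • G x) (u₀ j) (u j)) →
        (∀ j, ∃ C₀ : ℝ, ∀ t : ℝ, 0 ≤ t → kineticEnergy (u j t) ≤ C₀) →
        (∀ j, ∫ x, u₀ j x = c • EuclideanSpace.single 0 1) →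
        (∀ j, meanEnergy (u j) ≤ E) →
        ∃ δ : ℝ, 0 < δ ∧ ∃ (Λ : GeneralizedLimit) (J : ℕ), ∀ j, J ≤ j →
          Λ.longTimeAvg (fun t =>
            (∫ x, ⟪C x, u j t x⟫) * (∫ x, ⟪u j t x, convect (u j t) C x⟫) +
              (∫ x, ⟪S x, u j t x⟫) * (∫ x, ⟪u j t x, convect (u j t) S x⟫)) ≤ -δ

/-- **D1 assembly, proved: `DcNoReversalLaw → AcDragLaw → C`** (the birth skeleton's composition
`AcdcFirstMomentLaw_of`, with the two stubs as hypotheses; real content = the landed modal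
`α`-balance `stub_alphaBalance` and `stub_acWorkOfQuadratureDrag`). [folklore] -/
theorem crux_of_dcNoReversal_of_acDrag : DcNoReversalLaw → AcDragLaw → AcdcFirstMomentLaw := by
  intro hDC hAC
  obtain ⟨m, A, θ, c, hm, hA, hθ, hc, hac⟩ := hAC
  refine ⟨m, A, θ, c, hm, hA, hθ, hc, ?_⟩
  intro Φ G hΦd hGd ν u₀ u E hν hν0 hLH hsup hdrift hE
  -- the sawtooth and the swept quadrature pair of the design
  set Ψ : 𝕋³ → ℝ := fun x => θ / Real.pi * (UnitAddTorus.mFourier (Pi.single (0 : Fin 3) (1 : ℤ)) x).im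
    with hΨd
  set C : 𝕋³ → E³ := fun x => (UnitAddTorus.mFourier (Pi.single (0 : Fin 3) (1 : ℤ)) x).re • G x
    with hCd
  set S : 𝕋³ → E³ := fun x => (UnitAddTorus.mFourier (Pi.single (0 : Fin 3) (1 : ℤ)) x).im • G x
    with hSd
  obtain ⟨-, -, -, -, -, -, -, -, hfs, -, -, hCs, hSs, hCdiv, hSdiv, hΔC, hΔS, hACid⟩ :=
    stub_acdcDesignCalculus m A θ Φ Ψ G C S hΦd hΨd hGd hCd hSd hm hA hθ
  obtain ⟨-, -, hfC, hfS, -, hGpos⟩ :=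
    stub_acdcDesignIntegrals m A θ Φ Ψ G C S hΦd hΨd hGd hCd hSd hm hA hθ
  -- the two laws applied to the family
  obtain ⟨δ, hδ, Λ, J₁, hJ₁⟩ := hac Φ G C S hΦd hGd hCd hSd ν u₀ u E hν hν0 hLH hsup hdrift hE
  obtain ⟨J₂, hJ₂⟩ := hDC m A θ c hm hA hθ hc Φ G hΦd hGd ν u₀ u E hν hν0 hLH hsup hdrift hE
  have hκ : 0 < θ * ∫ x, ‖G x‖ ^ 2 := mul_pos hθ hGpos
  have hμ : 0 < 4 * Real.pi ^ 2 * (2 * (m : ℝ) ^ 2 + 1) := by positivity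
  refine ⟨2 * θ * (δ / (θ * ∫ x, ‖G x‖ ^ 2)), by positivity, Λ, max J₁ J₂, fun j hj => ⟨?_, ?_⟩⟩
  · -- (DC) no reversal, at this `Λ`
    exact hJ₂ j ((le_max_right _ _).trans hj) Λ
  · -- (AC) work floor from AC eddy drag by the exact modal balance
    have hX : δ / (θ * ∫ x, ‖G x‖ ^ 2) ≤ Λ.longTimeAvg (fun t => ∫ x, ⟪C x, u j t x⟫) :=
      stub_acWorkOfQuadratureDrag Λ (ν j) (4 * Real.pi ^ 2 * (2 * (m : ℝ) ^ 2 + 1))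
        (θ * ∫ x, ‖G x‖ ^ 2) δ (fun x => Φ x • G x) C S (u₀ j) (u j) stub_alphaBalance hfs hCs hSs
        hCdiv hSdiv hΔC hΔS (mul_pos (hν j) hμ).le hfC hκ hfS (hLH j) (hsup j)
        (hJ₁ j ((le_max_left _ _).trans hj))
    have hACwork : Λ.longTimeAvg (fun t => ∫ x, ⟪(Φ x - 1) • G x, u j t x⟫) =
        (2 * θ) * Λ.longTimeAvg (fun t => ∫ x, ⟪C x, u j t x⟫) := by
      rw [← Λ.longTimeAvg_const_mul]
      congr 1
      funext t
      rw [← integral_const_mul]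
      refine integral_congr_ae (ae_of_all _ fun x => ?_)
      show ⟪(Φ x - 1) • G x, u j t x⟫ = 2 * θ * ⟪C x, u j t x⟫
      rw [hACid x, real_inner_smul_left]
    show 2 * θ * (δ / (θ * ∫ x, ‖G x‖ ^ 2)) ≤
      Λ.longTimeAvg (fun t => ∫ x, ⟪(Φ x - 1) • G x, u j t x⟫)
    rw [hACwork]
    exact mul_le_mul_of_nonneg_left hX (by positivity)

/-! ### §5 Negation, typed: what a disprover must build -/

/-- **What refutes `C`**: at EVERY admissible parameter, a bounded-energy drift family along which,
for every `κ > 0`, every generalized limit and every threshold, some later member has a reversed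
DC mean or an AC mean below `κ`. [folklore] -/
def QuietOrReversingFamilies : Prop :=
  ∀ (m : ℕ) (A θ c : ℝ), 1 ≤ m → 0 < A → 0 < θ → 0 < c →
    ∃ (Φ : 𝕋³ → ℝ) (G : 𝕋³ → E³), IsAcdcProfile θ Φ ∧ IsAcdcPattern m A G ∧
      ∃ (ν : ℕ → ℝ) (u₀ : ℕ → 𝕋³ → E³) (u : ℕ → ℝ → 𝕋³ → E³) (E : ℝ),
        IsBoundedDriftFamily Φ G c ν u₀ u E ∧
        ∀ κ : ℝ, 0 < κ → ∀ (Λ : GeneralizedLimit) (J : ℕ), ∃ j, J ≤ j ∧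
          (Λ.longTimeAvg (fun t => ∫ x, ⟪G x, u j t x⟫) < 0 ∨
            Λ.longTimeAvg (fun t => ∫ x, ⟪(Φ x - 1) • G x, u j t x⟫) < κ)

/-- `QuietOrReversingFamilies → ¬C`. [folklore] -/
theorem not_crux_of_quietOrReversing (h : QuietOrReversingFamilies) : ¬ AcdcFirstMomentLaw := by
  rintro ⟨m, A, θ, c, hm, hA, hθ, hc, hlaw⟩
  obtain ⟨Φ, G, hΦd, hGd, ν, u₀, u, E, ⟨hν, hν0, hu, hsup, hdrift, hE⟩, hbad⟩ :=
    h m A θ c hm hA hθ hc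
  obtain ⟨κ, hκ, Λ, J, hJ⟩ := hlaw Φ G hΦd hGd ν u₀ u E hν hν0 hu hsup hdrift hE
  obtain ⟨j, hj, hj'⟩ := hbad κ hκ Λ J
  obtain ⟨ha, hb⟩ := hJ j hj
  rcases hj' with h' | h' <;> linarith

/-- `¬C → QuietOrReversingFamilies` (pure logic): so **`¬C ↔ QuietOrReversingFamilies`**. [folklore] -/
theorem quietOrReversing_of_not_crux (h : ¬ AcdcFirstMomentLaw) : QuietOrReversingFamilies := by
  intro m A θ c hm hA hθ hc
  by_contra hcon
  apply h
  refine ⟨m, A, θ, c, hm, hA, hθ, hc, ?_⟩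
  intro Φ G hΦd hGd ν u₀ u E hν hν0 hu hsup hdrift hE
  by_contra hlaw
  apply hcon
  refine ⟨Φ, G, hΦd, hGd, ν, u₀, u, E, ⟨hν, hν0, hu, hsup, hdrift, hE⟩, ?_⟩
  intro κ hκ Λ J
  by_contra hnone
  apply hlaw
  refine ⟨κ, hκ, Λ, J, fun j hj => ?_⟩
  by_contra hjbad
  apply hnone
  refine ⟨j, hj, ?_⟩
  by_contra hor
  exact hjbad ⟨not_lt.1 fun h' => hor (Or.inl h'), not_lt.1 fun h' => hor (Or.inr h')⟩

/-- `¬C ↔ QuietOrReversingFamilies`. [folklore] -/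
theorem not_crux_iff_quietOrReversing : ¬ AcdcFirstMomentLaw ↔ QuietOrReversingFamilies :=
  ⟨quietOrReversing_of_not_crux, not_crux_of_quietOrReversing⟩

/-- **Refuting `C` presupposes the sibling's open existence problem at EVERY parameter**: any
refutation exhibits, for all `(m, A, θ, c)`, a ν-uniformly bounded-energy vanishing-viscosity
Leray–Hopf drift family of the AC/DC force (the `UEDF` wall of the stmt-14350 census, AC/DC slice)
— before any sign is tested. [folklore] -/
theorem boundedDriftFamilies_of_not_crux (h : ¬ AcdcFirstMomentLaw) :
    ∀ (m : ℕ) (A θ c : ℝ), 1 ≤ m → 0 < A → 0 < θ → 0 < c →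
      ∃ (Φ : 𝕋³ → ℝ) (G : 𝕋³ → E³), IsAcdcProfile θ Φ ∧ IsAcdcPattern m A G ∧
        ∃ (ν : ℕ → ℝ) (u₀ : ℕ → 𝕋³ → E³) (u : ℕ → ℝ → 𝕋³ → E³) (E : ℝ),
          IsBoundedDriftFamily Φ G c ν u₀ u E := by
  intro m A θ c hm hA hθ hc
  obtain ⟨Φ, G, hΦd, hGd, ν, u₀, u, E, hfam, -⟩ := quietOrReversing_of_not_crux h m A θ c hm hA hθ hc
  exact ⟨Φ, G, hΦd, hGd, ν, u₀, u, E, hfam⟩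

/-- Dually, **the vacuity door is the ONLY way `C` and `¬(bounded families exist)` interact**:
`NoBoundedDriftFamilyAt` at some parameters makes `QuietOrReversingFamilies` false there, i.e.
proves `C` (= `crux_of_noBoundedDriftFamily`). [folklore] -/
theorem not_quietOrReversing_of_noBoundedDriftFamily {m : ℕ} {A θ c : ℝ} (hm : 1 ≤ m)
    (hA : 0 < A) (hθ : 0 < θ) (hc : 0 < c) (hno : NoBoundedDriftFamilyAt m A θ c) :
    ¬ QuietOrReversingFamilies := fun h => by
  obtain ⟨Φ, G, hΦd, hGd, ν, u₀, u, E, hfam, -⟩ := h m A θ c hm hA hθ hc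
  exact hno Φ G hΦd hGd ν u₀ u E hfam

end Summit.AnomalousDissipation.AnomalousDissipation.Cruxes.AcdcFirstMomentLaw.StrategyCensus

end
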